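import Summits.QuantumFields.BalabanUV.Beta.GAN24.AliasDecimate
import Summits.QuantumFields.BalabanUV.Beta.GAN24.FibreContinuity

/-!
# `BalabanUV.Beta.GAN24.FineReadoutCauchyFrame` — THE FRAME OF «(N1-Cauchy)»: the cell-mean one-step comparison of the normalised minimiser column is ONE lattice kernel; a strip bound on its symbol IS the estimate

**G-an2-4 FORMALISATION SWARM, b2b-balaban-gan24-formalise-leaf-17 (gen 11) — PART F of the located leaf «(N1-Cauchy)» of the S3 RATE
table** (owner's typed spec `HOME/b2b-balaban-gan24-p1/N1-CAUCHY-SPEC.md` v1; holder leaf-17, CLAIMS «N1-CAUCHY*»; division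
`HOME/b2b-balaban-gan24-formalise-leaf-17/g11/N1-CAUCHY-DIVISION.md`).  NOT IN PRINT; OUR PROOF ATTEMPT.  [folklore] bookkeeping, no analysis.

HONEST FRAMING (verbatim): «discharging `BetaPertH` makes Bałaban's UV stability UNCONDITIONAL — a real constructive-QFT result;
it is NOT the continuum limit and NOT the Clay problem.»
HONEST DEPENDENCY (verbatim): «continuum YM on T⁴ ⇐ BetaPertH ∧ nine spine estimates (0/9 proved); BetaPertH ⇐ (D1) ∧ (D4) ∧ CAP+tail;
G-an2-4 gates asym, D1 and NE2/3/4.»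

## What is here
«(N1-Cauchy)» compares the `Lc`-CELL MEAN of the next level's normalised minimiser column `N′^{d+2}·wH_{N′}` (`N′ = N·Lc`), read on the
dilated cell `{Lc•z + r : r ∈ box Lc}`, with this level's `N^{d+2}·wH_N` at `z`.
* §1 `quo_mul_cell` / `quo_cell`: the dilation KEEPS THE BLOCK LABEL — `quo (N·Lc) (Lc•z + toSite r) = quo N z` for `r ∈ box Lc`.
* §2 `diffSym N N′ Lc κ l z` — THE DIFFERENCE SYMBOL, a function of ONE coarse momentum — and **`cellMean_sub_eq_re_latticeKernel`**:
  `(Lc^{d+1})⁻¹·Σ_{r ∈ box Lc} N′^{d+2}·wH_{N′} κ l (Lc•z + r) − N^{d+2}·wH_N κ l z = Re latticeKernel (diffSym N N′ Lc κ l z) (quo N z)`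
  (both levels are lattice kernels over the SAME block-label torus, `CombesThomasFibre.wH_eq_re_latticeKernel`; no change of torus is needed
  in the cell-mean form — the pointwise/decimated form is `GAN24/MinimiserColumnDecimate`).
* §3 **`exists_wH_cellMean_cauchy_of_strip`**: a strip bound `StripRegular (diffSym (Lc^(n+1)) (Lc^(n+2)) Lc κ l z) κ₁ (c·θ^n)` for all
  `n κ l z` gives the owner's §1 statement VERBATIM (generic `d`; constants `(c, θ, κ₁/(d+1))`), by pv17's `B4ContourShift.latticeKernel_decay`
  and `|·|₁ ≤ (d+1)‖·‖∞` (inlined).  So «(N1-Cauchy)» ⇔ a uniform strip bound on the difference symbols; PART N (`GAN24/FineReadoutCauchyFold`)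
  writes `diffSym` alias by alias.
Discharges NOTHING of `(hS, hSall)`; the strip bound is the open analytic content (division PARTS A/C/K).  0 sorry, axioms
{propext, Classical.choice, Quot.sound}.
-/

noncomputable section

open Complex Finset
open scoped Real BigOperators
open Literature.MathematicalPhysics.QuantumFieldTheory
open Literature.MathematicalPhysics.QuantumFieldTheory.Balaban1983to89
open Literature.MathematicalPhysics.QuantumFieldTheory.Balaban1983to89.Beta
open Literature.Probability.LatticeModels (TorusSite Torus.proj)
open LatticeForm (quo)
open B12Sec2to5 (l1 l1_nonneg)
open B4Strip (ofRealVec)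
open B4ContourShift (latticeKernel BZ integrand StripRegular supNorm abs_le_supNorm latticeKernel_decay)
open BlochFibreMatrix (Idx)
open AffineAveraging (box toSite)
open KernelSpecInstance (wH)
open OneStepResolventKernel (Fib)
open Beta.FibreInverseDecay (isCompact_BZ)
open Summit.QuantumFields.BalabanUV.Beta.GAN24.CombesThomasFibre (fibInv wH_eq_re_latticeKernel)
open Summit.QuantumFields.BalabanUV.Beta.GAN24.FibreContinuity (continuous_fibInv_ofRealVec)
open Summit.QuantumFields.BalabanUV.Beta.GAN24.AliasDecimate (continuous_integrand)

namespace Summit.QuantumFields.BalabanUV.Beta.GAN24.FineReadoutCauchyFrame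

variable {d : ℕ}

/-! ## §1 Cell arithmetic: the fine cell `Lc•z + r`, `r ∈ box Lc`, of the next blocking has the block label of `z` -/

/-- [folklore] A cell point: `0 ≤ r_i < Lc`. -/
theorem toSite_mem_range {Lc : ℕ} {r : Fin (d + 1) → ℕ} (hr : r ∈ box (d + 1) Lc) (i : Fin (d + 1)) :
    0 ≤ toSite r i ∧ toSite r i < (Lc : ℤ) := by
  have h := (Fintype.mem_piFinset.mp hr) i
  rw [Finset.mem_range] at h
  exact ⟨by simp [toSite], by simp only [toSite]; exact_mod_cast h⟩

/-- [folklore] **THE BLOCK LABEL IS KEPT BY THE DILATION**: for `r ∈ box Lc`, `quo (N·Lc) (Lc•z + toSite r) = quo N z`. -/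
theorem quo_mul_cell (N Lc : ℕ) [NeZero Lc] (z : Fin (d + 1) → ℤ) {r : Fin (d + 1) → ℕ} (hr : r ∈ box (d + 1) Lc) :
    quo (N * Lc) ((Lc : ℤ) • z + toSite r) = quo N z := by
  funext i
  obtain ⟨h0, hlt⟩ := toSite_mem_range hr i
  have hLc : (0 : ℤ) < Lc := by exact_mod_cast Nat.pos_of_ne_zero (NeZero.ne Lc)
  simp only [quo, Pi.add_apply, Pi.smul_apply, smul_eq_mul, Nat.cast_mul]
  rw [mul_comm ((N : ℤ)) (Lc : ℤ), ← Int.ediv_ediv_of_nonneg hLc.le]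
  congr 1
  rw [show (Lc : ℤ) * z i + toSite r i = toSite r i + (Lc : ℤ) * z i by ring, Int.add_mul_ediv_left _ _ hLc.ne',
    Int.ediv_eq_zero_of_lt h0 hlt, zero_add]

/-- [folklore] The same with the next blocking named `N′ = N·Lc`. -/
theorem quo_cell {N N' Lc : ℕ} [NeZero Lc] (hN : N' = N * Lc) (z : Fin (d + 1) → ℤ) {r : Fin (d + 1) → ℕ}
    (hr : r ∈ box (d + 1) Lc) : quo N' ((Lc : ℤ) • z + toSite r) = quo N z := by
  subst hN; exact quo_mul_cell N Lc z hr

/-! ## §2 The difference symbol and THE FRAME IDENTITY -/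

/-- [folklore] **THE DIFFERENCE SYMBOL of the cell-mean one-step comparison** of the normalised minimiser column (blockings `N′` above
`N`, dilation factor `Lc`, field direction `κ`, source direction `l`, fine site `z`):
`D(p) = (Lc^{d+1})⁻¹·N′^{d+2}·Σ_{r ∈ box Lc} (F_{N′}(p)⁻¹)_{(κ, box pos. of Lc•z+r),(Q,l)} − N^{d+2}·(F_N(p)⁻¹)_{(κ, box pos. of z),(Q,l)}` —
a function of ONE coarse momentum `p` (the two blockings share the block-label torus). -/
def diffSym (N N' Lc : ℕ) [NeZero N] [NeZero N'] (κ l : Fin (d + 1)) (z : Fin (d + 1) → ℤ) : (Fin (d + 1) → ℂ) → ℂ :=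
  fun p => (((Lc : ℂ) ^ (d + 1))⁻¹ * ((N' : ℂ) ^ (d + 2)) *
      ∑ r ∈ box (d + 1) Lc, fibInv N' (Sum.inl (κ, Torus.proj N' ((Lc : ℤ) • z + toSite r))) (Sum.inr (Sum.inr l)) p) -
    ((N : ℂ) ^ (d + 2)) * fibInv N (Sum.inl (κ, Torus.proj N z)) (Sum.inr (Sum.inr l)) p

/-- [folklore] The integrand of an inverse-fibre entry is integrable on the zone (continuity at every real momentum,
`FibreContinuity.continuous_fibInv_ofRealVec`). -/
theorem integrableOn_integrand_fibInv (N : ℕ) [NeZero N] (i j : Idx (d + 1) N) (x : Fin (d + 1) → ℤ) :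
    MeasureTheory.IntegrableOn (integrand (fibInv N i j) x) (BZ (d + 1)) :=
  (continuous_integrand (continuous_fibInv_ofRealVec i j) x).continuousOn.integrableOn_compact (isCompact_BZ _)

/-- [folklore] The cell sum of the next level's column, read at the block label of `z`, is ONE lattice kernel. -/
theorem sum_wH_cell_eq (N N' Lc : ℕ) [NeZero N] [NeZero N'] [NeZero Lc] (hN : N' = N * Lc) (κ l : Fin (d + 1))
    (z : Fin (d + 1) → ℤ) :
    ∑ r ∈ box (d + 1) Lc, wH (N := N') κ l ((Lc : ℤ) • z + toSite r) =
      (latticeKernel (fun p => ∑ r ∈ box (d + 1) Lc,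
        fibInv N' (Sum.inl (κ, Torus.proj N' ((Lc : ℤ) • z + toSite r))) (Sum.inr (Sum.inr l)) p) (quo N z)).re := by
  have h : ∀ r ∈ box (d + 1) Lc, wH (N := N') κ l ((Lc : ℤ) • z + toSite r) =
      (latticeKernel (fibInv N' (Sum.inl (κ, Torus.proj N' ((Lc : ℤ) • z + toSite r))) (Sum.inr (Sum.inr l))) (quo N z)).re := by
    intro r hr
    rw [wH_eq_re_latticeKernel, quo_cell hN z hr]
  rw [Finset.sum_congr rfl h, ← Complex.re_sum]
  congr 1
  have hs := B4Green244.latticeKernel_sum_mul (box (d + 1) Lc) (fun _ => (1 : ℂ))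
    (fun r => fibInv N' (Sum.inl (κ, Torus.proj N' ((Lc : ℤ) • z + toSite r))) (Sum.inr (Sum.inr l))) (quo N z)
    (fun r _ => integrableOn_integrand_fibInv N' _ _ _)
  simp only [one_mul] at hs
  exact hs.symm

/-- [folklore] **THE FRAME IDENTITY**: the left side of «(N1-Cauchy)» — the `Lc`-cell mean of the next level's normalised minimiser column
minus this level's — is the real part of the lattice kernel of the DIFFERENCE SYMBOL, read at the block label of `z`:
`(Lc^{d+1})⁻¹·Σ_{r ∈ box Lc} N′^{d+2}·wH_{N′} κ l (Lc•z + r) − N^{d+2}·wH_N κ l z = Re latticeKernel (diffSym N N′ Lc κ l z) (quo N z)`, `N′ = N·Lc`. -/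
theorem cellMean_sub_eq_re_latticeKernel (N N' Lc : ℕ) [NeZero N] [NeZero N'] [NeZero Lc] (hN : N' = N * Lc)
    (κ l : Fin (d + 1)) (z : Fin (d + 1) → ℤ) :
    ((Lc : ℝ) ^ (d + 1))⁻¹ * ∑ r ∈ box (d + 1) Lc, ((N' : ℝ) ^ (d + 2)) * wH (N := N') κ l ((Lc : ℤ) • z + toSite r) -
        ((N : ℝ) ^ (d + 2)) * wH (N := N) κ l z =
      (latticeKernel (diffSym N N' Lc κ l z) (quo N z)).re := by
  have hI1 : MeasureTheory.IntegrableOn (integrand (fun p => (((Lc : ℂ) ^ (d + 1))⁻¹ * ((N' : ℂ) ^ (d + 2))) *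
      ∑ r ∈ box (d + 1) Lc, fibInv N' (Sum.inl (κ, Torus.proj N' ((Lc : ℤ) • z + toSite r))) (Sum.inr (Sum.inr l)) p)
      (quo N z)) (BZ (d + 1)) := by
    refine (continuous_integrand ?_ (quo N z)).continuousOn.integrableOn_compact (isCompact_BZ _)
    exact continuous_const.mul (continuous_finsetSum _ fun r _ => continuous_fibInv_ofRealVec _ _)
  have hI2 : MeasureTheory.IntegrableOn (integrand (fun p => ((N : ℂ) ^ (d + 2)) *
      fibInv N (Sum.inl (κ, Torus.proj N z)) (Sum.inr (Sum.inr l)) p) (quo N z)) (BZ (d + 1)) :=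
    (continuous_integrand (continuous_const.mul (continuous_fibInv_ofRealVec _ _)) (quo N z)).continuousOn.integrableOn_compact
      (isCompact_BZ _)
  rw [← Finset.mul_sum, sum_wH_cell_eq N N' Lc hN, wH_eq_re_latticeKernel]
  unfold diffSym
  rw [B4Green242Bridge.latticeKernel_sub (quo N z) hI1 hI2, B4Green242Bridge.latticeKernel_const_mul,
    B4Green242Bridge.latticeKernel_const_mul, Complex.sub_re]
  congr 1
  · rw [show (((Lc : ℂ) ^ (d + 1))⁻¹ * ((N' : ℂ) ^ (d + 2))) = ((((Lc : ℝ) ^ (d + 1))⁻¹ * ((N' : ℝ) ^ (d + 2)) : ℝ) : ℂ) by push_cast; ring,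
      Complex.re_ofReal_mul, mul_assoc]
  · rw [show ((N : ℂ) ^ (d + 2)) = ((((N : ℝ) ^ (d + 2)) : ℝ) : ℂ) by push_cast; ring, Complex.re_ofReal_mul]

/-! ## §3 STRIP ⇒ «(N1-Cauchy)»: a strip bound on the difference symbol gives the cell-mean convergence with block decay -/

/-- [folklore] **STRIP ⇒ POINT BOUND**: a strip bound `‖D(p)‖ ≤ M` on `|Im p| ≤ κ₁` for the difference symbol gives
`|cell mean − column| ≤ M·e^{−(κ₁/(d+1))·|quo N z|₁}` (pv17's `latticeKernel_decay`, sup → ℓ¹ rate). -/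
theorem abs_cellMean_sub_le_of_stripRegular (N N' Lc : ℕ) [NeZero N] [NeZero N'] [NeZero Lc] (hN : N' = N * Lc)
    {κ₁ M : ℝ} (hκ₁ : 0 ≤ κ₁) (κ l : Fin (d + 1)) (z : Fin (d + 1) → ℤ) (hD : StripRegular (diffSym N N' Lc κ l z) κ₁ M) :
    |((Lc : ℝ) ^ (d + 1))⁻¹ * ∑ r ∈ box (d + 1) Lc, ((N' : ℝ) ^ (d + 2)) * wH (N := N') κ l ((Lc : ℤ) • z + toSite r) -
        ((N : ℝ) ^ (d + 2)) * wH (N := N) κ l z| ≤ M * Real.exp (-(κ₁ / (d + 1)) * l1 (quo N z)) := by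
  rw [cellMean_sub_eq_re_latticeKernel N N' Lc hN κ l z]
  have h1 := latticeKernel_decay hD hκ₁ (quo N z)
  have hM : 0 ≤ M := le_trans (norm_nonneg _) (hD.bound _ (B4ContourShift.ofRealVec_mem_Strip hκ₁
    (show (fun _ : Fin (d + 1) => (0 : ℝ)) ∈ BZ (d + 1) from ⟨fun _ => by simp [Real.pi_pos.le], fun _ => by simp [Real.pi_pos.le]⟩)))
  refine (Complex.abs_re_le_norm _).trans (h1.trans ?_)
  refine mul_le_mul_of_nonneg_left ?_ hM
  rw [Real.exp_le_exp]
  -- `|x|₁ ≤ (d+1)·‖x‖∞` (inlined; the tree's `T4GaugeActionRatePair.l1_le_mul_supNorm` lives in an unrelated import cone)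
  have hl : l1 (quo N z) ≤ ((d : ℝ) + 1) * supNorm (quo N z) := by
    unfold l1
    calc ∑ μ, |((quo N z μ : ℤ) : ℝ)| ≤ ∑ _μ : Fin (d + 1), supNorm (quo N z) := by
          refine Finset.sum_le_sum fun μ _ => ?_
          have h := abs_le_supNorm (quo N z) μ
          rwa [Int.cast_abs] at h
      _ = ((d : ℝ) + 1) * supNorm (quo N z) := by
          rw [Finset.sum_const, Finset.card_univ, Fintype.card_fin, nsmul_eq_mul]; push_cast; ring
  have hd : (0 : ℝ) < (d : ℝ) + 1 := by positivity
  have : κ₁ / (d + 1) * l1 (quo N z) ≤ κ₁ * supNorm (quo N z) := by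
    calc κ₁ / (d + 1) * l1 (quo N z) ≤ κ₁ / (d + 1) * (((d : ℝ) + 1) * supNorm (quo N z)) :=
          mul_le_mul_of_nonneg_left hl (div_nonneg hκ₁ hd.le)
      _ = κ₁ * supNorm (quo N z) := by field_simp
  linarith

/-- [folklore] **«(N1-Cauchy)» FROM A UNIFORM STRIP BOUND ON THE DIFFERENCE SYMBOLS** (generic `d`; the reduction of the owner's
`N1-CAUCHY-SPEC.md` §1 to its §3(d)): if for some `κ₁ > 0`, `c ≥ 0`, `0 ≤ θ < 1` every difference symbol of the consecutive blockings
`Lc^{n+1} ⊂ Lc^{n+2}` is strip regular with bound `c·θ^n`, then the cell means of the normalised minimiser columns converge geometrically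
in the member with block decay — the LITERAL shape of «(N1-Cauchy)» (rate `κ₁/(d+1)` in the `ℓ¹` block norm). -/
theorem exists_wH_cellMean_cauchy_of_strip (Lc : ℕ) [NeZero Lc] {κ₁ c θ : ℝ} (hκ₁ : 0 < κ₁) (hc : 0 ≤ c) (hθ0 : 0 ≤ θ)
    (hθ1 : θ < 1)
    (hD : ∀ (n : ℕ) (κ l : Fin (d + 1)) (z : Fin (d + 1) → ℤ),
      StripRegular (diffSym (Lc ^ (n + 1)) (Lc ^ (n + 2)) Lc κ l z) κ₁ (c * θ ^ n)) :
    ∃ c' θ' κ' : ℝ, 0 ≤ c' ∧ 0 ≤ θ' ∧ θ' < 1 ∧ 0 < κ' ∧ ∀ (n : ℕ) (κ l : Fin (d + 1)) (z : Fin (d + 1) → ℤ),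
      |((Lc : ℝ) ^ (d + 1))⁻¹ * ∑ r ∈ box (d + 1) Lc,
            ((Lc : ℝ) ^ (n + 2)) ^ (d + 2) * wH (N := Lc ^ (n + 2)) κ l ((Lc : ℤ) • z + toSite r) -
          ((Lc : ℝ) ^ (n + 1)) ^ (d + 2) * wH (N := Lc ^ (n + 1)) κ l z| ≤
        c' * θ' ^ n * Real.exp (-κ' * l1 (quo (Lc ^ (n + 1)) z)) := by
  refine ⟨c, θ, κ₁ / (d + 1), hc, hθ0, hθ1, by positivity, fun n κ l z => ?_⟩
  have h := abs_cellMean_sub_le_of_stripRegular (Lc ^ (n + 1)) (Lc ^ (n + 2)) Lc (pow_succ Lc (n + 1)) hκ₁.le κ l z (hD n κ l z)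
  have e1 : (((Lc ^ (n + 2) : ℕ) : ℝ) ^ (d + 2)) = ((Lc : ℝ) ^ (n + 2)) ^ (d + 2) := by push_cast; ring
  have e2 : (((Lc ^ (n + 1) : ℕ) : ℝ) ^ (d + 2)) = ((Lc : ℝ) ^ (n + 1)) ^ (d + 2) := by push_cast; ring
  rw [e1, e2] at h
  simpa only [neg_mul] using h

end Summit.QuantumFields.BalabanUV.Beta.GAN24.FineReadoutCauchyFrame

end
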